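import Summits.ABC.StewartYu.ArchG3ScheduleD
import Summits.ABC.StewartYu.ArchG3SatData
import HarnessLib

/-!
# Cell abc-stewartyu, rung A1.L (crux r2 `ArchCoreRat`), WP-L.A: the PACK INPUTS of the one-stage archimedean frame at `S(θ)` — the text of
# `stub_packsArch` (R38 (3)): all per-level D-packages in the virtual instance, and the last-level state they buy

`Summits/ABC/StewartYu/ArchG3PacksV.lean` — cell `abc-stewartyu` (HOME `run/shared/lean/pub/abc-stewartyu/`; plan RULINGS R34, R38 (3) («v4 re-cut:
`stub_satStartArch` (p1) + `stub_packsArch` (p5)»), 19:03:54Z («p5's PackInputs letters typed»); seat p5 g8).  One definition and one theorem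
on `ArchG3Setup`; no named fact, no numerics.

* **`ArchPacksHoldV`** — the conjunction of the four package families consumed by lp-1's `lastLevelState_of_scheduleD` (level-`0` symmetric
  k-steps `hK0`, half-steps `hH`, odd-node first steps `hO`, symmetric k-steps `hK` at the levels `1 ≤ lev ≤ Ŝ`), for the level polynomials
  `Rᵢ = Δ(·; i.1, H) ∘ 2^{Ŝ−lev}·`, the boxes `Lb s lev`, and the VIRTUAL-BOX predicates `V lev w := ∀ j, |ν(w)ⱼ| ≤ Bv lev j` (`ν(w) = w ᵥ* F.U`,
  `F : S.SatData`).  This is the proposed TEXT of `Sig.stub_packsArch` (quantified by the registrar over the START's outputs `S(θ), F, U, P, δ₀`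
  and the record's schedules `H, Ŝ, s, wl, γb, cl, el, N, T, Nh, Bv`); its proof is `ArchG3PackLinesV`/`…VH` applied level-wise to the
  record's letter lines (`ArchG3RecA/B`, seat p1).
* **`lastLevelStateQ_of_packsV`** — `ArchPacksHoldV` + the family invariant `Q` with its two links (`hQhalf`, `hQV`) + the slab schedule laws +
  2-independence + `|Λ/b_{j₀}| ≤ δ₀` + the level-`0` state ⇒ the last-level state `ArchLevelStateQ Q … Ŝ (N Ŝ n) (T Ŝ n)` (one line over
  `lastLevelState_of_scheduleD`).

WHAT THIS IS NOT: no inequality, no record; no crux moves.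

## References
* Yu. V. Nesterenko, LNM 1819 (2003) — §4 Prop. 4.1 (the induction over `(s, ν)`), §4.2–4.3 p. 83–95. [Nesterenko2003]
-/

noncomputable section

open Finset Polynomial
open scoped Matrix
open Literature.NumberTheory.Transcendental
open Summit.ABC.StewartYu.ArchSupply (scaledFeldR)

namespace Summit.ABC.StewartYu

namespace ArchG3Setup

variable (S : ArchG3Setup)

/-- **The pack inputs of the one-stage frame at `S(θ)`** (virtual instance): the four package families of `lastLevelState_of_scheduleD`
with `V lev w := ∀ j, |(w ᵥ* F.U) j| ≤ Bv lev j`. [cite: Nesterenko2003, §4 Prop. 4.1, §4.2–4.3; shape only] -/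
def ArchPacksHoldV (F : S.SatData) (H Sh : ℕ) (s : Fin S.n → ℕ) (U : Finset (ℕ × (Fin S.n → ℤ))) (P : ℤ) (δ₀ : ℝ)
    (wl γb : ℕ → ℝ) (cl : ℕ → ℤ) (el : ℕ → Fin S.n → ℤ) (Bv : ℕ → Fin S.n → ℕ) (N T : ℕ → ℕ → ℕ) (Nh : ℕ → ℕ) : Prop :=
  (∀ ν, ν < S.n → S.ArchKStepHypD (fun i : ℕ × (Fin S.n → ℤ) => scaledFeldR i.1 H (Sh - 0)) U (S.Lb s 0) P (wl 0) (γb 0) (cl 0) (el 0) δ₀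
      (fun w' => ∀ j, |(w' ᵥ* F.U) j| ≤ (Bv 0 j : ℤ)) (N 0 ν) (N 0 (ν + 1)) (T 0 ν) (T 0 (ν + 1))) ∧
  (∀ lev < Sh, S.ArchHalfStepHypD (fun i : ℕ × (Fin S.n → ℤ) => scaledFeldR i.1 H (Sh - lev))
      (fun i : ℕ × (Fin S.n → ℤ) => scaledFeldR i.1 H (Sh - (lev + 1))) U (S.Lb s lev) P (wl lev) (γb lev) (cl lev) (el lev) (cl (lev + 1)) δ₀
      (fun w' => ∀ j, |(w' ᵥ* F.U) j| ≤ (Bv lev j : ℤ)) (N lev S.n) (Nh (lev + 1)) (T lev S.n) (T (lev + 1) 0)) ∧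
  (∀ lev < Sh, S.ArchKStepOddHypD (fun i : ℕ × (Fin S.n → ℤ) => scaledFeldR i.1 H (Sh - (lev + 1))) U (S.Lb s (lev + 1)) P (wl (lev + 1))
      (γb (lev + 1)) (cl (lev + 1)) (el (lev + 1)) δ₀ (fun w' => ∀ j, |(w' ᵥ* F.U) j| ≤ (Bv (lev + 1) j : ℤ)) (Nh (lev + 1)) (N (lev + 1) 1)
      (T (lev + 1) 0) (T (lev + 1) 1)) ∧
  (∀ lev < Sh, ∀ ν, 1 ≤ ν → ν < S.n → S.ArchKStepHypD (fun i : ℕ × (Fin S.n → ℤ) => scaledFeldR i.1 H (Sh - (lev + 1))) U (S.Lb s (lev + 1)) P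
      (wl (lev + 1)) (γb (lev + 1)) (cl (lev + 1)) (el (lev + 1)) δ₀ (fun w' => ∀ j, |(w' ᵥ* F.U) j| ≤ (Bv (lev + 1) j : ℤ))
      (N (lev + 1) ν) (N (lev + 1) (ν + 1)) (T (lev + 1) ν) (T (lev + 1) (ν + 1)))

/-- **The packs buy the last-level state**: `ArchPacksHoldV` together with the family invariant `Q` (links `hQhalf`, `hQV` to the virtual boxes
`Bv lev`), the slab laws `wl (lev+1) = wl lev/2 ≤ γb (lev+1)`, the independence of the square classes, `|Λ/b_{j₀}| ≤ δ₀` and the level-`0` state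
gives `ArchLevelStateQ Q H Ŝ s U pv P wl γb cl el Ŝ (N Ŝ n) (T Ŝ n)` (lp-1's `lastLevelState_of_scheduleD`).
[cite: Nesterenko2003, §4 Prop. 4.1; shape only] -/
theorem lastLevelStateQ_of_packsV (F : S.SatData) {Q : Finset (ℕ × (Fin S.n → ℤ)) → ((ℕ × (Fin S.n → ℤ)) → Fin S.n → ℤ) → ℕ → Prop}
    {H Sh : ℕ} {s : Fin S.n → ℕ} {U : Finset (ℕ × (Fin S.n → ℤ))} {pv : ℕ × (Fin S.n → ℤ) → ℤ} {P : ℤ} {δ₀ : ℝ} {wl γb : ℕ → ℝ}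
    {cl : ℕ → ℤ} {el : ℕ → Fin S.n → ℤ} {Bv : ℕ → Fin S.n → ℕ} {N T : ℕ → ℕ → ℕ} {Nh : ℕ → ℕ} (hn : 1 ≤ S.n)
    (hind : ∀ T₁ : Finset (Fin S.n), T₁.Nonempty → ¬ IsSquare (∏ j ∈ T₁, S.α j)) (hΛ : |S.Λ / (S.b S.j₀ : ℝ)| ≤ δ₀)
    (hQhalf : ∀ (lev : ℕ) (B : Finset (ℕ × (Fin S.n → ℤ))) (v : ℕ × (Fin S.n → ℤ) → Fin S.n → ℤ) (i₀ : ℕ × (Fin S.n → ℤ)),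
      i₀ ∈ B → Q B v lev → Q (S.parityClass v B i₀) (S.halfDiff v i₀) (lev + 1))
    (hQV : ∀ lev B v, Q B v lev → ∀ i ∈ B, ∀ j, |(v i ᵥ* F.U) j| ≤ (Bv lev j : ℤ))
    (hwl : ∀ lev, wl (lev + 1) = wl lev / 2) (hγb : ∀ lev, wl lev / 2 ≤ γb (lev + 1))
    (hpacks : S.ArchPacksHoldV F H Sh s U P δ₀ wl γb cl el Bv N T Nh)
    (h00 : S.ArchLevelStateQ Q H Sh s U pv P wl γb cl el 0 (N 0 0) (T 0 0)) :
    S.ArchLevelStateQ Q H Sh s U pv P wl γb cl el Sh (N Sh S.n) (T Sh S.n) :=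
  S.lastLevelState_of_scheduleD (V := fun lev w' => ∀ j, |(w' ᵥ* F.U) j| ≤ (Bv lev j : ℤ)) hn hind hΛ hQhalf hQV N T Nh hwl hγb
    hpacks.1 hpacks.2.1 hpacks.2.2.1 hpacks.2.2.2 h00

end ArchG3Setup

end Summit.ABC.StewartYu

end
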